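import Summits.Ventures.CertifiedManyBodySolver.Observables.LocalPairCeiling
import Summits.Ventures.CertifiedManyBodySolver.Rows.DopedTLCorr
import Literature.MathematicalPhysics.QuantumLattice.InfVolFermionStateBounds
import Literature.MathematicalPhysics.QuantumLattice.HubbardNNNHoppingClusterEmbedding
import HarnessLib

/-!
# The local singlet-pair ceiling in the thermodynamic limit: `|Re ω(P_x† P_y)| ≤ Σ_e g(e)²`

HONEST FRAMING: first certified bounds; not a superconductivity verdict; every number certified or
labelled float.  Speedrun `mbsolver`, seat sr-mbsolver-m3-2 (pairing layer), gen 12.  Certificate-free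
KINEMATIC statements (every infinite-volume state of the CAR algebra of `ℤ²`; no Hamiltonian, no energy
window): the a-priori EDGES against which a certified thermodynamic-limit pair row is graded (M3.md §4,
R-M3-22), not evidence about pairing.  Theorem-only; no definition, no named fact; zero compute.

`Observables/LocalPairCeiling.lean` (gen 11) proved `P† P ≤ 2 Σ_e |c_e|²` for a site–bond-mode singlet on
any finite ordered site set and drew the torus consequences.  Here the inequality is read in the local
algebras `𝔄_Λ`, `Λ ⊂ ℤ²` finite, for the tree's `localPairAt S g x ∈ 𝔄_{pairRegion S x}`
(`InfVolFermionState.lean` §5) and pushed to states and to the row grammar of `Rows/DopedTLCorr.lean`: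
* §1 `posSemidef_smul_one_sub_localPairAt`: `(P_x)† P_x ≤ (Σ_{e∈S} g(e)²)·1` if `g 0 = 0` whenever
  `0 ∈ S` (the tree's `d`-wave convention); `d`-wave `≤ 4·1`; generic `A†A, B†B ≤ ν ⇒ ∓(A†B + B†A) ≤ 2ν`.
* §2 every `ω : InfVolFermionState 2`: `0 ≤ Re ω(P_x† P_x) ≤ Σ g²` and **`|Re ω.pairCorr S g x y| ≤ Σ g²`**
  for ALL `x, y` (positivity + Hermiticity; no Cauchy–Schwarz); `d`-wave `|Re ω.dWavePairCorr x y| ≤ 4`.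
* §3 rows: at EVERY `(t′, U, n)` and every window `u` the `d`-wave pair word `Γ(P_x)† Γ(P_y)` (literally
  the word of `InfVolFermionState.corr`: `dWavePairCorr_eq_expect` is `rfl`) carries the certificate-free
  cells `SquareTTPrimeCorrLowerRow … (-4)`, `…UpperRow … 4`, diagonal `…LowerRow … 0`; M3′ names
  `m3_dWavePair_lowerRow / upperRow / self_lowerRow`.  A certified TL pair row is INFORMATIVE iff strictly
  inside `[-4, 4]` (resp. `[0, 4]`).
* §4 torus family (class `TL-fam`): for a unit vector of a torus of side `L ≥ 3`, nonempty `S ⊆ D₄`, any `r`,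
  `|(L²|S|)⁻¹ Σ_{γ∈S} Re⟨ψ, Σ_x P_x† P_{x+γr̄} ψ⟩| ≤ 4` — the literal quantity of the tree's pair-row consumer
  `re_sum_pairCorrSum_groundState_ge_of_window_certificate_d4_TT'_dWave`.

References: D. J. Scalapino, Phys. Rep. 250 (1995) 329, §2 eq. (2.2)–(2.4); O. Bratteli, D. W. Robinson,
Operator Algebras and Quantum Statistical Mechanics I, §2.3.2; G. L. Sewell, J. Math. Phys. 11 (1970)
1868, §4.  Folklore otherwise; nothing here is specific to the Hubbard model.
-/


noncomputable section

namespace Summit.Ventures.CertifiedManyBodySolver.Observables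
open Matrix Literature.MathematicalPhysics.QuantumLattice Literature.Probability.LatticeModels
open scoped ComplexOrder ComplexConjugate BigOperators

namespace SingletPair

/-! ## §1 Operator level: the local pair of `ℤ²` in its own local algebra -/

section Operator

/-- **Two contractions have bounded cross terms**: `A† A, B† B ≤ ν ⇒ A† B + B† A ≤ 2ν`
(`2ν - (A†B + B†A) = (ν - A†A) + (ν - B†B) + (A - B)†(A - B)`). Bratteli–Robinson I §2.3.2. [folklore] -/
theorem posSemidef_smul_one_sub_cross {n : Type*} [Fintype n] [DecidableEq n] {A B : Matrix n n ℂ}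
    {ν : ℝ} (hA : (((ν : ℝ) : ℂ) • (1 : Matrix n n ℂ) - Aᴴ * A).PosSemidef)
    (hB : (((ν : ℝ) : ℂ) • (1 : Matrix n n ℂ) - Bᴴ * B).PosSemidef) :
    ((((2 * ν : ℝ)) : ℂ) • (1 : Matrix n n ℂ) - (Aᴴ * B + Bᴴ * A)).PosSemidef := by
  have h := (hA.add hB).add (Matrix.posSemidef_conjTranspose_mul_self (A - B))
  have hid : (((2 * ν : ℝ)) : ℂ) • (1 : Matrix n n ℂ) - (Aᴴ * B + Bᴴ * A) =
      ((ν : ℝ) : ℂ) • (1 : Matrix n n ℂ) - Aᴴ * A + (((ν : ℝ) : ℂ) • (1 : Matrix n n ℂ) - Bᴴ * B) +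
        (A - B)ᴴ * (A - B) := by
    rw [Matrix.conjTranspose_sub, Matrix.sub_mul, Matrix.mul_sub, Matrix.mul_sub,
      show (((2 * ν : ℝ)) : ℂ) = ((ν : ℝ) : ℂ) + ((ν : ℝ) : ℂ) by push_cast; ring, add_smul]
    abel
  rw [hid]
  exact h

/-- The companion with the opposite sign: `A† A, B† B ≤ ν ⇒ -(A† B + B† A) ≤ 2ν`
(`2ν + (A†B + B†A) = (ν - A†A) + (ν - B†B) + (A + B)†(A + B)`). Bratteli–Robinson I §2.3.2. [folklore] -/
theorem posSemidef_smul_one_add_cross {n : Type*} [Fintype n] [DecidableEq n] {A B : Matrix n n ℂ}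
    {ν : ℝ} (hA : (((ν : ℝ) : ℂ) • (1 : Matrix n n ℂ) - Aᴴ * A).PosSemidef)
    (hB : (((ν : ℝ) : ℂ) • (1 : Matrix n n ℂ) - Bᴴ * B).PosSemidef) :
    ((((2 * ν : ℝ)) : ℂ) • (1 : Matrix n n ℂ) + (Aᴴ * B + Bᴴ * A)).PosSemidef := by
  have h := (hA.add hB).add (Matrix.posSemidef_conjTranspose_mul_self (A + B))
  have hid : (((2 * ν : ℝ)) : ℂ) • (1 : Matrix n n ℂ) + (Aᴴ * B + Bᴴ * A) =
      ((ν : ℝ) : ℂ) • (1 : Matrix n n ℂ) - Aᴴ * A + (((ν : ℝ) : ℂ) • (1 : Matrix n n ℂ) - Bᴴ * B) +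
        (A + B)ᴴ * (A + B) := by
    rw [Matrix.conjTranspose_add, Matrix.add_mul, Matrix.mul_add, Matrix.mul_add,
      show (((2 * ν : ℝ)) : ℂ) = ((ν : ℝ) : ℂ) + ((ν : ℝ) : ℂ) by push_cast; ring, add_smul]
    abel
  rw [hid]
  exact h

variable (S : Finset (Site 2)) (g : Site 2 → ℝ) (x : Site 2)

/-- The infinite-lattice local pair as a site–bond-mode singlet `P_x = a_{x↑} ψ_↓ - a_{x↓} ψ_↑`,
`ψ_σ = Σ_{e∈S} (g e/√2) a_{(x+e)σ}`, in `𝔄_{pairRegion S x}`. Scalapino, Phys. Rep. 250 (1995) 329, §2. [folklore] -/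
theorem localPairAt_eq_sitePair :
    localPairAt S g x =
      annihilation (orb (PolySite.pt x (self_mem_pairRegion S x)) 0) *
          (∑ e ∈ S.attach, ((g e.1 / Real.sqrt 2 : ℝ) : ℂ) •
            annihilation (orb (PolySite.pt (x + e.1) (add_mem_pairRegion x e.2)) 1)) -
        annihilation (orb (PolySite.pt x (self_mem_pairRegion S x)) 1) *
          (∑ e ∈ S.attach, ((g e.1 / Real.sqrt 2 : ℝ) : ℂ) •
            annihilation (orb (PolySite.pt (x + e.1) (add_mem_pairRegion x e.2)) 0)) := by
  simp only [localPairAt, cAt, smul_sub, Finset.sum_sub_distrib, Finset.mul_sum, Matrix.mul_smul]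

/-- **The singlet-pair ceiling in `𝔄_{pairRegion S x}`**: `(P_x)† P_x ≤ (Σ_{e∈S} g(e)²)·1` for the
infinite-lattice local pair `P_x = localPairAt S g x`, provided the on-site weight vanishes when `0 ∈ S`
(on `ℤ²` the shifted sites `x + e`, `e ≠ 0`, are automatically distinct from `x` and from each other —
no torus-size hypothesis). Scalapino, Phys. Rep. 250 (1995) 329, §2 eq. (2.2)–(2.4). [folklore] -/
theorem posSemidef_smul_one_sub_localPairAt (hg : (0 : Site 2) ∈ S → g 0 = 0) :
    ((((∑ e ∈ S, g e ^ 2 : ℝ)) : ℂ) • (1 : FermionOp (pairRegion S x)) -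
      (localPairAt S g x)ᴴ * localPairAt S g x).PosSemidef := by
  classical
  set c : S → ℂ := fun e => ((g e.1 / Real.sqrt 2 : ℝ) : ℂ) with hc
  set v : S → PolySite (pairRegion S x) := fun e => PolySite.pt (x + e.1) (add_mem_pairRegion x e.2)
    with hv
  set E : Finset S := S.attach.filter fun e => e.1 ≠ 0 with hE
  -- the on-site term (if any) has weight `g 0 / √2 = 0`
  have hc0 : ∀ e : S, e.1 = 0 → c e = 0 := by
    intro e he
    have : g e.1 = 0 := by rw [he]; exact hg (he ▸ e.2)
    simp [hc, this]
  have hsum : ∀ σ : Fin 2,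
      ∑ e ∈ S.attach, c e • annihilation (orb (v e) σ) = ∑ e ∈ E, c e • annihilation (orb (v e) σ) := by
    intro σ
    rw [hE, Finset.sum_filter_of_ne]
    intro e _ hne
    by_contra h0
    exact hne (by rw [hc0 e h0, zero_smul])
  have hinj : Set.InjOn v E := by
    intro e _ e' _ h
    have h' := congrArg (fun p : PolySite (pairRegion S x) => ofLex p.1) h
    simp only [hv, PolySite.ofLex_coe_pt, add_right_inj] at h'
    exact Subtype.ext h'
  have hoff : ∀ e ∈ E, v e ≠ PolySite.pt x (self_mem_pairRegion S x) := by
    intro e he h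
    have h' := congrArg (fun p : PolySite (pairRegion S x) => ofLex p.1) h
    simp only [hv, PolySite.ofLex_coe_pt, add_eq_left] at h'
    exact (Finset.mem_filter.1 he).2 h'
  have hconst : (2 : ℝ) * ∑ e ∈ E, ‖c e‖ ^ 2 = ∑ e ∈ S, g e ^ 2 := by
    have h1 : ∀ e : S, (2 : ℝ) * ‖c e‖ ^ 2 = g e.1 ^ 2 := by
      intro e
      rw [hc, Complex.norm_real, Real.norm_eq_abs, sq_abs, div_pow, Real.sq_sqrt zero_le_two]
      ring
    rw [Finset.mul_sum, Finset.sum_congr rfl fun e _ => h1 e, hE, Finset.sum_filter_of_ne,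
      Finset.sum_attach S fun e => g e ^ 2]
    intro e _ hne h0
    exact hne (by rw [h0, hg (h0 ▸ e.2), zero_pow two_ne_zero])
  have h := posSemidef_smul_one_sub_sitePair E c v (PolySite.pt x (self_mem_pairRegion S x)) hinj hoff
  rw [hconst, ← hsum 0, ← hsum 1] at h
  rw [localPairAt_eq_sitePair]
  convert h

/-- **`(P_x)† P_x ≤ 4` for the `d_{x²-y²}` local pair of `ℤ²`** (`S = {0} ∪ unitSteps`,
`g = dWaveFormFactor`, the pair of `InfVolFermionState.dWavePairCorr`), in `𝔄_{pairRegion x}`.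
Scalapino, Phys. Rep. 250 (1995) 329, §2 eq. (2.2)–(2.4). [folklore] -/
theorem posSemidef_four_smul_one_sub_localPairAt_dWave (x : Site 2) :
    ((4 : ℂ) • (1 : FermionOp (pairRegion (insert 0 unitSteps) x)) -
      (localPairAt (insert 0 unitSteps) dWaveFormFactor x)ᴴ *
        localPairAt (insert 0 unitSteps) dWaveFormFactor x).PosSemidef := by
  have h := posSemidef_smul_one_sub_localPairAt (insert 0 unitSteps) dWaveFormFactor x
    (fun _ => dWaveFormFactor_zero)
  rw [PairFieldYang.sum_sq_dWaveFormFactor] at h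
  convert h using 3
  norm_num

end Operator

/-! ## §2 Every infinite-volume state of the CAR algebra of `ℤ²` -/

section State

variable (ω : InfVolFermionState 2) (S : Finset (Site 2)) (g : Site 2 → ℝ)

/-- The ceiling survives isotony: `Γ(P_x)† Γ(P_x) ≤ (Σ_{e∈S} g(e)²)·1` in any region `Λ ⊇ pairRegion S x`
(`Γ = fermionEmbed (PolySite.incl _)`, a unital `*`-map). Araki–Moriya 2003 §4.1. [folklore] -/
theorem posSemidef_smul_one_sub_fermionEmbed_localPairAt {Λ : Finset (Site 2)} (x : Site 2)
    (h : pairRegion S x ⊆ Λ) (hg : (0 : Site 2) ∈ S → g 0 = 0) :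
    ((((∑ e ∈ S, g e ^ 2 : ℝ)) : ℂ) • (1 : FermionOp Λ) -
      (fermionEmbed (PolySite.incl h) (localPairAt S g x))ᴴ *
        fermionEmbed (PolySite.incl h) (localPairAt S g x)).PosSemidef := by
  have h1 := posSemidef_fermionEmbed (PolySite.incl h) (posSemidef_smul_one_sub_localPairAt S g x hg)
  rw [fermionEmbed_sub, fermionEmbed_smul, fermionEmbed_one, fermionEmbed_mul,
    fermionEmbed_conjTranspose] at h1
  convert h1 using 2

/-- **`0 ≤ Re ω(P_x† P_x)`** for every state (positivity). Bratteli–Robinson I, Def. 2.3.9.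
[cite: BratteliRobinsonI1987, Def. 2.3.9] -/
theorem re_pairCorr_self_nonneg (x : Site 2) : 0 ≤ (ω.pairCorr S g x x).re := by
  rw [InfVolFermionState.pairCorr, InfVolFermionState.corr_eq, fermionEmbed_conjTranspose]
  exact ω.expect_re_nonneg_of_posSemidef _ (Matrix.posSemidef_conjTranspose_mul_self _)

/-- **`Re ω(P_x† P_x) ≤ Σ_{e∈S} g(e)²`** for every state (`g 0 = 0` if `0 ∈ S`).
Scalapino, Phys. Rep. 250 (1995) 329, §2 eq. (2.4); Bratteli–Robinson I, Def. 2.3.9. [folklore] -/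
theorem re_pairCorr_self_le (x : Site 2) (hg : (0 : Site 2) ∈ S → g 0 = 0) :
    (ω.pairCorr S g x x).re ≤ ∑ e ∈ S, g e ^ 2 := by
  have h := ω.expect_re_nonneg_of_posSemidef _
    (posSemidef_smul_one_sub_fermionEmbed_localPairAt S g x
      (Finset.subset_union_right : pairRegion S x ⊆ pairRegion S x ∪ pairRegion S x) hg)
  rw [map_sub, map_smul, ω.expect_one, Complex.sub_re, smul_eq_mul, mul_one, Complex.ofReal_re,
    sub_nonneg] at h
  rwa [InfVolFermionState.pairCorr, InfVolFermionState.corr_eq, fermionEmbed_conjTranspose]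

/-- **The pair two-point function of every state is bounded by the one-pair ceiling**:
`|Re ω.pairCorr S g x y| = |Re ω(P_x† P_y)| ≤ Σ_{e∈S} g(e)²` for ALL sites `x, y` — from
`∓(A†B + B†A) ≤ 2ν` (`posSemidef_smul_one_sub_cross` / `…_add_cross`) in the local algebra of
`pairRegion S x ∪ pairRegion S y`, state positivity and Hermiticity `ω(B†A) = conj ω(A†B)`.
Scalapino, Phys. Rep. 250 (1995) 329, §2 eq. (2.4); Sewell 1970 §4. [cite: BratteliRobinsonI1987, Def. 2.3.9] -/
theorem abs_re_pairCorr_le (hg : (0 : Site 2) ∈ S → g 0 = 0) (x y : Site 2) :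
    |(ω.pairCorr S g x y).re| ≤ ∑ e ∈ S, g e ^ 2 := by
  have hpA := posSemidef_smul_one_sub_fermionEmbed_localPairAt S g x
    (Finset.subset_union_left : pairRegion S x ⊆ pairRegion S x ∪ pairRegion S y) hg
  have hpB := posSemidef_smul_one_sub_fermionEmbed_localPairAt S g y
    (Finset.subset_union_right : pairRegion S y ⊆ pairRegion S x ∪ pairRegion S y) hg
  have hcorr : ω.pairCorr S g x y = ω.expect (pairRegion S x ∪ pairRegion S y)
      ((fermionEmbed (PolySite.incl Finset.subset_union_left) (localPairAt S g x))ᴴ *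
        fermionEmbed (PolySite.incl Finset.subset_union_right) (localPairAt S g y)) := by
    rw [InfVolFermionState.pairCorr, InfVolFermionState.corr_eq, fermionEmbed_conjTranspose]
  have hre : (ω.expect (pairRegion S x ∪ pairRegion S y)
      ((fermionEmbed (PolySite.incl Finset.subset_union_right) (localPairAt S g y))ᴴ *
        fermionEmbed (PolySite.incl Finset.subset_union_left) (localPairAt S g x))).re =
      (ω.expect (pairRegion S x ∪ pairRegion S y)
      ((fermionEmbed (PolySite.incl Finset.subset_union_left) (localPairAt S g x))ᴴ *
        fermionEmbed (PolySite.incl Finset.subset_union_right) (localPairAt S g y))).re := by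
    rw [show (fermionEmbed (PolySite.incl Finset.subset_union_right) (localPairAt S g y))ᴴ *
        fermionEmbed (PolySite.incl Finset.subset_union_left) (localPairAt S g x) =
        ((fermionEmbed (PolySite.incl Finset.subset_union_left) (localPairAt S g x))ᴴ *
          fermionEmbed (PolySite.incl (Finset.subset_union_right :
            pairRegion S y ⊆ pairRegion S x ∪ pairRegion S y)) (localPairAt S g y))ᴴ by
        rw [Matrix.conjTranspose_mul, Matrix.conjTranspose_conjTranspose],
      ω.expect_conjTranspose, Complex.star_def, Complex.conj_re]
  have h1 := ω.expect_re_nonneg_of_posSemidef _ (posSemidef_smul_one_sub_cross hpA hpB)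
  have h2 := ω.expect_re_nonneg_of_posSemidef _ (posSemidef_smul_one_add_cross hpA hpB)
  rw [map_sub, map_smul, ω.expect_one, map_add, Complex.sub_re, Complex.add_re, smul_eq_mul, mul_one,
    Complex.ofReal_re] at h1
  rw [map_add, map_smul, ω.expect_one, map_add, Complex.add_re, Complex.add_re, smul_eq_mul, mul_one,
    Complex.ofReal_re] at h2
  rw [hcorr, abs_le]
  constructor <;> linarith

/-- **`d`-wave: `|Re ω.dWavePairCorr x y| ≤ 4`** for every state and all `x, y` (the tree's
`d_{x²-y²}` pair, `S = {0} ∪ unitSteps`, `g = dWaveFormFactor`). Scalapino, Phys. Rep. 250 (1995) 329,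
§2 eq. (2.3)–(2.4). [cite: BratteliRobinsonI1987, Def. 2.3.9] -/
theorem abs_re_dWavePairCorr_le_four (x y : Site 2) : |(ω.dWavePairCorr x y).re| ≤ 4 := by
  have h := abs_re_pairCorr_le ω (insert 0 unitSteps) dWaveFormFactor (fun _ => dWaveFormFactor_zero) x y
  rwa [PairFieldYang.sum_sq_dWaveFormFactor] at h

/-- `d`-wave, diagonal: `0 ≤ Re ω.dWavePairCorr x x`. [cite: BratteliRobinsonI1987, Def. 2.3.9] -/
theorem re_dWavePairCorr_self_nonneg (x : Site 2) : 0 ≤ (ω.dWavePairCorr x x).re :=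
  re_pairCorr_self_nonneg ω _ _ x

/-- `d`-wave, diagonal: `Re ω.dWavePairCorr x x ≤ 4`. Scalapino, Phys. Rep. 250 (1995) 329, §2 eq. (2.4).
[cite: BratteliRobinsonI1987, Def. 2.3.9] -/
theorem re_dWavePairCorr_self_le_four (x : Site 2) : (ω.dWavePairCorr x x).re ≤ 4 := by
  have h := re_pairCorr_self_le ω (insert 0 unitSteps) dWaveFormFactor x (fun _ => dWaveFormFactor_zero)
  rwa [PairFieldYang.sum_sq_dWaveFormFactor] at h

end State

/-! ## §4 The torus-family edge (class `TL-fam`) -/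

section TorusFamily

variable (L : ℕ) [NeZero L]

/-- **The kinematic box of the torus-family pair rows.**  For a unit vector `ψ` of a torus of side
`L ≥ 3`, nonempty `S ⊆ D₄` and a displacement `r`, the `S`- and translation-averaged `d`-wave pair
correlator `(L²|S|)⁻¹ Σ_{γ∈S} Re⟨ψ, (Σ_x P_x† P_{x+γ·r̄}) ψ⟩` (the literal quantity of the tree's consumer
`re_sum_pairCorrSum_groundState_ge_of_window_certificate_d4_TT'_dWave`) has modulus `≤ 4` (each of the
`L²|S|` terms is bounded by `abs_re_expect_localPair_dWave_le_four`). Certificate-free; a certified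
torus-family pair row is informative iff strictly inside. Scalapino, Phys. Rep. 250 (1995) 329, §2. [folklore] -/
theorem abs_sum_re_pairCorrSum_dWave_div_le_four (hL : 3 ≤ L) {S : Finset (DihedralGroup 4)}
    (hS : S.Nonempty) (r : Site 2) (ψ : Fock (Orb (FermionTorus 2 L))) (hψ1 : star ψ ⬝ᵥ ψ = 1) :
    |(∑ γ' ∈ S, (star ψ ⬝ᵥ ((∑ x : TorusSite 2 L,
        (localPair dWaveFormFactor L x)ᴴ * localPair dWaveFormFactor L (x + d4Site γ' (Torus.proj L r))) *ᵥ
          ψ)).re) / ((L : ℝ) ^ 2 * S.card)| ≤ 4 := by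
  have hL2 : (0 : ℝ) < (L : ℝ) ^ 2 := by
    have : (0 : ℝ) < L := by exact_mod_cast (show 0 < L by omega)
    positivity
  have hSc : (0 : ℝ) < S.card := by exact_mod_cast hS.card_pos
  have hterm : ∀ γ' ∈ S, |(star ψ ⬝ᵥ ((∑ x : TorusSite 2 L, (localPair dWaveFormFactor L x)ᴴ *
      localPair dWaveFormFactor L (x + d4Site γ' (Torus.proj L r))) *ᵥ ψ)).re| ≤ 4 * (L : ℝ) ^ 2 := by
    intro γ' _
    rw [Matrix.sum_mulVec, dotProduct_sum, Complex.re_sum]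
    refine (Finset.abs_sum_le_sum_abs _ _).trans ?_
    calc ∑ x : TorusSite 2 L, |(star ψ ⬝ᵥ (((localPair dWaveFormFactor L x)ᴴ *
            localPair dWaveFormFactor L (x + d4Site γ' (Torus.proj L r))) *ᵥ ψ)).re|
        ≤ ∑ _x : TorusSite 2 L, (4 : ℝ) := Finset.sum_le_sum fun x _ =>
          abs_re_expect_localPair_dWave_le_four L hL ψ hψ1 x _
      _ = 4 * (L : ℝ) ^ 2 := by
          have hcard : Fintype.card (TorusSite 2 L) = L ^ 2 := by simp [ZMod.card]
          rw [Finset.sum_const, Finset.card_univ, hcard, nsmul_eq_mul]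
          push_cast
          ring
  rw [abs_div, abs_of_pos (mul_pos hL2 hSc), div_le_iff₀ (mul_pos hL2 hSc)]
  refine (Finset.abs_sum_le_sum_abs _ _).trans ?_
  calc ∑ γ' ∈ S, |(star ψ ⬝ᵥ ((∑ x : TorusSite 2 L, (localPair dWaveFormFactor L x)ᴴ *
          localPair dWaveFormFactor L (x + d4Site γ' (Torus.proj L r))) *ᵥ ψ)).re|
      ≤ ∑ _γ' ∈ S, 4 * (L : ℝ) ^ 2 := Finset.sum_le_sum hterm
    _ = 4 * ((L : ℝ) ^ 2 * S.card) := by rw [Finset.sum_const, nsmul_eq_mul]; ring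

end TorusFamily

end SingletPair

end Summit.Ventures.CertifiedManyBodySolver.Observables

/-! ## §3 The row grammar: certificate-free cells of the `d`-wave pair two-point word -/

namespace Summit.Ventures.CertifiedManyBodySolver

open Matrix Literature.MathematicalPhysics.QuantumLattice Literature.Probability.LatticeModels
open Literature.MathematicalPhysics.QuantumLattice.HubbardWave0
open ThermodynamicLimit Filter Topology
open scoped BigOperators ComplexOrder

/-- **The `d`-wave pair two-point WORD** `Γ(P_x)† Γ(P_y)` in the local algebra of
`pairRegion x ∪ pairRegion y` (`P = localPairAt ({0} ∪ unitSteps) dWaveFormFactor`, `Γ` the isotony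
embeddings) is literally the word of `InfVolFermionState.corr`: `ω.dWavePairCorr x y = ω.expect _ (word)`
by `rfl`.  It is the word a thermodynamic-limit pair row is typed on (below), so such a row provably speaks
about `ω.dWavePairCorr`. Scalapino, Phys. Rep. 250 (1995) 329, §2 eq. (2.4). [cite: Sewell1970, §4 (Thm. 4.3)] -/
theorem dWavePairCorr_eq_expect (ω : InfVolFermionState 2) (x y : Site 2) :
    ω.dWavePairCorr x y = ω.expect (pairRegion (insert 0 unitSteps) x ∪ pairRegion (insert 0 unitSteps) y)
      (fermionEmbed (PolySite.incl Finset.subset_union_left)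
          (localPairAt (insert 0 unitSteps) dWaveFormFactor x)ᴴ *
        fermionEmbed (PolySite.incl Finset.subset_union_right)
          (localPairAt (insert 0 unitSteps) dWaveFormFactor y)) := rfl

/-- **Certificate-free LOWER cell `-4`** of the `d`-wave pair two-point word at EVERY `(t′, U, n)` and
every energy window `u` (the hypotheses of the row are not used): the a-priori lower EDGE of a
thermodynamic-limit `d`-wave pair row. Scalapino, Phys. Rep. 250 (1995) 329, §2 eq. (2.4). [folklore] -/
theorem squareTTPrime_dWavePair_lowerRow (tp U n : ℝ) (u : ℚ) (x y : Site 2) :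
    SquareTTPrimeCorrLowerRow tp U n u (-4)
      (pairRegion (insert 0 unitSteps) x ∪ pairRegion (insert 0 unitSteps) y)
      (fermionEmbed (PolySite.incl Finset.subset_union_left)
          (localPairAt (insert 0 unitSteps) dWaveFormFactor x)ᴴ *
        fermionEmbed (PolySite.incl Finset.subset_union_right)
          (localPairAt (insert 0 unitSteps) dWaveFormFactor y)) := by
  intro ω Ls ψ _ _ _ _ _
  have h := (abs_le.1 (Observables.SingletPair.abs_re_dWavePairCorr_le_four ω x y)).1
  push_cast
  exact h

/-- **Certificate-free UPPER cell `4`** of the `d`-wave pair two-point word at every `(t′, U, n, u)`: the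
a-priori upper EDGE. Scalapino, Phys. Rep. 250 (1995) 329, §2 eq. (2.4). [folklore] -/
theorem squareTTPrime_dWavePair_upperRow (tp U n : ℝ) (u : ℚ) (x y : Site 2) :
    SquareTTPrimeCorrUpperRow tp U n u 4
      (pairRegion (insert 0 unitSteps) x ∪ pairRegion (insert 0 unitSteps) y)
      (fermionEmbed (PolySite.incl Finset.subset_union_left)
          (localPairAt (insert 0 unitSteps) dWaveFormFactor x)ᴴ *
        fermionEmbed (PolySite.incl Finset.subset_union_right)
          (localPairAt (insert 0 unitSteps) dWaveFormFactor y)) := by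
  intro ω Ls ψ _ _ _ _ _
  have h := (abs_le.1 (Observables.SingletPair.abs_re_dWavePairCorr_le_four ω x y)).2
  push_cast
  exact h

/-- **Certificate-free diagonal LOWER cell `0`** (`Re ω(P_x† P_x) ≥ 0`) at every `(t′, U, n, u)`.
[cite: BratteliRobinsonI1987, Def. 2.3.9] -/
theorem squareTTPrime_dWavePair_self_lowerRow (tp U n : ℝ) (u : ℚ) (x : Site 2) :
    SquareTTPrimeCorrLowerRow tp U n u 0
      (pairRegion (insert 0 unitSteps) x ∪ pairRegion (insert 0 unitSteps) x)
      (fermionEmbed (PolySite.incl Finset.subset_union_left)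
          (localPairAt (insert 0 unitSteps) dWaveFormFactor x)ᴴ *
        fermionEmbed (PolySite.incl Finset.subset_union_right)
          (localPairAt (insert 0 unitSteps) dWaveFormFactor x)) := by
  intro ω Ls ψ _ _ _ _ _
  have h := Observables.SingletPair.re_dWavePairCorr_self_nonneg ω x
  push_cast
  exact h

/-- M3′ point (`U = 8`, `n = 7/8`), every `t′` and every window `u`: the a-priori pair box, lower edge
`M3CorrLowerRow t′ u (-4) _ (word)`.  A certified TL pair LOWER row at the M3 point is informative iff its
constant is `> -4`. Scalapino, Phys. Rep. 250 (1995) 329, §2 eq. (2.4). [folklore] -/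
theorem m3_dWavePair_lowerRow (tp : ℝ) (u : ℚ) (x y : Site 2) :
    M3CorrLowerRow tp u (-4)
      (pairRegion (insert 0 unitSteps) x ∪ pairRegion (insert 0 unitSteps) y)
      (fermionEmbed (PolySite.incl Finset.subset_union_left)
          (localPairAt (insert 0 unitSteps) dWaveFormFactor x)ᴴ *
        fermionEmbed (PolySite.incl Finset.subset_union_right)
          (localPairAt (insert 0 unitSteps) dWaveFormFactor y)) :=
  squareTTPrime_dWavePair_lowerRow tp 8 (7 / 8) u x y

/-- M3′ point, every `t′`, every window: upper edge `M3CorrUpperRow t′ u 4 _ (word)`; a certified TL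
pair UPPER row is informative iff its constant is `< 4`. Scalapino, Phys. Rep. 250 (1995) 329, §2. [folklore] -/
theorem m3_dWavePair_upperRow (tp : ℝ) (u : ℚ) (x y : Site 2) :
    M3CorrUpperRow tp u 4
      (pairRegion (insert 0 unitSteps) x ∪ pairRegion (insert 0 unitSteps) y)
      (fermionEmbed (PolySite.incl Finset.subset_union_left)
          (localPairAt (insert 0 unitSteps) dWaveFormFactor x)ᴴ *
        fermionEmbed (PolySite.incl Finset.subset_union_right)
          (localPairAt (insert 0 unitSteps) dWaveFormFactor y)) :=
  squareTTPrime_dWavePair_upperRow tp 8 (7 / 8) u x y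

/-- M3′ point, every `t′`, every window, diagonal: `M3CorrLowerRow t′ u 0 _ (word at y = x)`.
[cite: BratteliRobinsonI1987, Def. 2.3.9] -/
theorem m3_dWavePair_self_lowerRow (tp : ℝ) (u : ℚ) (x : Site 2) :
    M3CorrLowerRow tp u 0
      (pairRegion (insert 0 unitSteps) x ∪ pairRegion (insert 0 unitSteps) x)
      (fermionEmbed (PolySite.incl Finset.subset_union_left)
          (localPairAt (insert 0 unitSteps) dWaveFormFactor x)ᴴ *
        fermionEmbed (PolySite.incl Finset.subset_union_right)
          (localPairAt (insert 0 unitSteps) dWaveFormFactor x)) :=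
  squareTTPrime_dWavePair_self_lowerRow tp 8 (7 / 8) u x

end Summit.Ventures.CertifiedManyBodySolver

end
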